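import Literature.RepresentationTheory.HeisenbergGroup.SchrodingerLeraySectionParabolic
import Literature.RepresentationTheory.HeisenbergGroup.SchrodingerPiOperatorsSmooth
import Literature.RepresentationTheory.HeisenbergGroup.SchrodingerUnramifiedVector
import Literature.NumberTheory.Automorphic.GLnCongruenceSubgroups
import HarnessLib

/-!
# The Schrödinger–Leray section fixes `1_{𝒪^ι}` on the integral generators (unramified situation)

Topic `RepresentationTheory/HeisenbergGroup`; namespace `Literature.RepresentationTheory.HeisenbergGroup`. KERNEL
mathematics only (theorems; no definition, no named fact, no `axiom`, no `sorry`). Sequel of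
`SchrodingerLeraySectionParabolic.lean` (`r(m(a)) = leviOpPi a`, `r(n(c)) = unipOpPi c`, `r(w) = 𝓕` for the
Schrödinger–Leray section `r` of `Sp(F^ι ⊕ F^ι)` on `𝒮(F^ι)`) and `SchrodingerUnramifiedVector.lean`
(`𝓕 1_{𝒪^ι} = μ^{⊗ι}(𝒪^ι) · 1_{𝒪^ι}`).

THE UNRAMIFIED SITUATION ([MoeglinVignerasWaldspurger1987] Chap. 2 II.10; [GelbartRogawski1991] §3.1 (3.1.3),
p. 456; [Weil1964] n° 19–20): `ψ` has conductor `𝒪 = 𝔭^0`, `2 ∈ 𝒪^×` (`½ ∈ 𝒪`) and `μ` is the self-dual Haar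
measure (so `μ^{⊗ι}(𝒪^ι) = 1`, `measureReal_integers_eq_one`). Then the NORMALISED operators of the three kinds
of generators of `Sp_{2ι}(𝒪)` FIX the unramified vector `Φ₀ = 1_{𝒪^ι}` EXACTLY (not only up to a scalar as in
`SchrodingerUnramifiedVector`):
* `leviOpPi_integersIndicator`: `r(m(a)) 1_{𝒪^ι} = |det a|^{-1/2} 1_{𝒪^ι}(a⁻¹ ·) = 1_{𝒪^ι}` for `[a], [a⁻¹] ∈ M_ι(𝒪)`
  (`|det a| = 1`, `modSqrt_eq_one_of_integral`);
* `unipOpPi_integersIndicator`: `r(n(c)) 1_{𝒪^ι} = ψ(-½⟨u, cu⟩) 1_{𝒪^ι} = 1_{𝒪^ι}` for `[c] ∈ M_ι(𝒪)`;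
* `fourierOpPi_integersIndicator_of_isSelfDualMeasure`: `r(w) 1_{𝒪^ι} = 𝓕 1_{𝒪^ι} = 1_{𝒪^ι}`;
and hence the Schrödinger–Leray section does: `schrodingerLeraySection_leviSp_integersIndicator`,
`…_unipotentSp_integersIndicator`, `…_leviSp_mul_unipotentSp_integersIndicator`, `…_weylSp_integersIndicator`,
`…_parabolic_weylSp_parabolic_integersIndicator` (`r(p₁ w p₂) 1 = 1` for integral `p₁, p₂ ∈ P_{ℓ_Y}`).
(On a PRODUCT of generators `r` picks up the Leray cocycle, `r(g₁g₂) = c(g₁,g₂)⁻¹ r(g₁) r(g₂)`; the values above are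
the input of the unramified clause `K_v · 1_{𝒪_v^N} = 1_{𝒪_v^N}` of [GelbartRogawski1991] (3.1.3) for a genuine
representation `β⁻¹ · r ∘ ι` of a group generated by such elements.)

Written for GR-1's stub `L7` (unramified clause) of the local splitting skeleton of [GelbartRogawski1991,
Prop. 3.1.1] (stage-1 cell `pub-hodgecm`, menu item M3). Nothing here is a claim of the manuscripts adjudicated there.

## References

* C. Mœglin, M.-F. Vignéras, J.-L. Waldspurger, LNM 1291 (1987), Chap. 2 II.6, II.10 [MoeglinVignerasWaldspurger1987].
* S. Gelbart, J. Rogawski, Invent. Math. 105 (1991), §3.1 (3.1.3), p. 456 [GelbartRogawski1991].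
* A. Weil, Acta Math. 111 (1964) 143–211: n° 13, n° 19–20 [Weil1964].
* A. Weil, *Basic Number Theory* (1967), Ch. VII §2 Cor. 1 (`(1_𝒪)^ = μ(𝒪) 1_𝒪` for `ψ` of conductor `𝒪`)
  [WeilBNT1967].
-/

set_option autoImplicit false

noncomputable section

namespace Literature.RepresentationTheory.HeisenbergGroup

open _root_.MeasureTheory Matrix ValuativeRel
open Literature.GroupTheory Literature.NumberTheory.Automorphic
open Literature.NumberTheory.GaloisRepresentations.IsNonarchimedeanLocalField
open Literature.NumberTheory.Weil1964 Literature.LinearAlgebra.QuadraticForm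

section Pi

variable {F : Type*} [Field F] [ValuativeRel F] [TopologicalSpace F] [IsNonarchimedeanLocalField F]
  {ι : Type*} [Fintype ι] [DecidableEq ι] [Invertible (2 : F)]
  {ψ : AddChar F Circle} (hl : IsLocallyConstant (⇑ψ : F → Circle))
  [MeasurableSpace F] [BorelSpace F] (μ : Measure F) [μ.IsAddHaarMeasure]
  (Φ₀ : SchwartzBruhat (ι → F)) (hΦ₀ : (Φ₀ : (ι → F) → ℂ) = (piPrimePowBall F ι 0).indicator fun _ => (1 : ℂ))

/-! ## §1 Integral automorphisms: `|det a| = 1`, `a⁻¹ 𝒪^ι = 𝒪^ι` -/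

omit [Fintype ι] [DecidableEq ι] [Invertible (2 : F)] [MeasurableSpace F] [BorelSpace F] in
/-- `𝔭^0 = 𝒪 = {v ≤ 1}`: an entrywise-integral matrix is `ValBound 1`. [cite: WeilBNT1967, Ch. II §2] -/
private theorem valBound_one_of_integral {X : Matrix ι ι F}
    (hX : ∀ i j, X i j ∈ primePowBall F 0) : ValBound 1 X := fun i j =>
  (Valuation.mem_integer_iff _ _).1 (normAbs_le_one_iff.1 (by simpa only [mem_primePowBall_iff, zpow_zero] using hX i j))

omit [Invertible (2 : F)] [MeasurableSpace F] [BorelSpace F] in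
/-- **`|det a| = 1` for `a` integral with integral inverse** (`det a`, `det a⁻¹ ∈ 𝒪` with product `1`), i.e.
`modSqrt a = 1`. [cite: WeilBNT1967, Ch. II §2, Prop. 4; MoeglinVignerasWaldspurger1987, Chap. 2 II.10] -/
theorem modSqrt_eq_one_of_integral (a : (ι → F) ≃ₗ[F] (ι → F))
    (ha : ∀ i j, LinearMap.toMatrix' (a : (ι → F) →ₗ[F] (ι → F)) i j ∈ primePowBall F 0)
    (ha' : ∀ i j, LinearMap.toMatrix' (a.symm : (ι → F) →ₗ[F] (ι → F)) i j ∈ primePowBall F 0) : modSqrt a = 1 := by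
  have h1 : valuation F (LinearMap.toMatrix' (a : (ι → F) →ₗ[F] (ι → F))).det ≤ 1 :=
    valuation_det_le_one (valBound_one_of_integral ha)
  have h2 : valuation F (LinearMap.toMatrix' (a.symm : (ι → F) →ₗ[F] (ι → F))).det ≤ 1 :=
    valuation_det_le_one (valBound_one_of_integral ha')
  have hprod : (LinearMap.toMatrix' (a : (ι → F) →ₗ[F] (ι → F))).det *
      (LinearMap.toMatrix' (a.symm : (ι → F) →ₗ[F] (ι → F))).det = 1 := by
    rw [← Matrix.det_mul, ← LinearMap.toMatrix'_comp]
    have : ((a : (ι → F) →ₗ[F] (ι → F)) ∘ₗ (a.symm : (ι → F) →ₗ[F] (ι → F))) = LinearMap.id := by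
      apply LinearMap.ext; intro x; simp
    rw [this, LinearMap.toMatrix'_id, Matrix.det_one]
  have hdet : valuation F (LinearMap.det (a : (ι → F) →ₗ[F] (ι → F))) = 1 := by
    rw [← LinearMap.det_toMatrix']
    refine le_antisymm h1 ?_
    have h := congrArg (valuation F) hprod
    rw [_root_.map_mul, _root_.map_one] at h
    calc (1 : ValueGroupWithZero F)
        = valuation F (LinearMap.toMatrix' (a : (ι → F) →ₗ[F] (ι → F))).det *
            valuation F (LinearMap.toMatrix' (a.symm : (ι → F) →ₗ[F] (ι → F))).det := h.symm
      _ ≤ valuation F (LinearMap.toMatrix' (a : (ι → F) →ₗ[F] (ι → F))).det * 1 := by gcongr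
      _ = _ := mul_one _
  rw [modSqrt, DeltaCharBorel.normAbs_eq_one_of_valuation_eq_one hdet, NNReal.coe_one, Real.sqrt_one]

omit [Invertible (2 : F)] [MeasurableSpace F] [BorelSpace F] in
/-- an integral linear map preserves `𝒪^ι`. [cite: WeilBNT1967, Ch. II §2, Prop. 4] -/
theorem apply_mem_integers_of_integral (c : (ι → F) →ₗ[F] (ι → F)) (hc : ∀ i j, LinearMap.toMatrix' c i j ∈ primePowBall F 0) {u : ι → F}
    (hu : u ∈ piPrimePowBall F ι 0) : c u ∈ piPrimePowBall F ι 0 := by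
  rw [← LinearMap.toMatrix'_mulVec c u]
  exact mulVec_mem_piPrimePowBall_zero hc hu

include hΦ₀ in
omit [Fintype ι] [DecidableEq ι] [Invertible (2 : F)] [MeasurableSpace F] [BorelSpace F] in
/-- `1_{𝒪^ι}` vanishes off `𝒪^ι`. [cite: Weil1964, n° 19, p. 167] -/
private theorem integersIndicator_eq_zero (u : ι → F) (hu : u ∉ piPrimePowBall F ι 0) : (Φ₀ : (ι → F) → ℂ) u = 0 := by
  rw [hΦ₀, Set.indicator_of_notMem hu]

include hΦ₀ in
omit [Fintype ι] [DecidableEq ι] [Invertible (2 : F)] [MeasurableSpace F] [BorelSpace F] in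
/-- `1_{𝒪^ι}` is `𝒪^ι`-periodic. [cite: Weil1964, n° 19, p. 167] -/
private theorem integersIndicator_add (x : ι → F) (t : ι → F) (ht : t ∈ piPrimePowBall F ι 0) :
    (Φ₀ : (ι → F) → ℂ) (x + t) = (Φ₀ : (ι → F) → ℂ) x := by
  rw [hΦ₀]
  by_cases hx : x ∈ piPrimePowBall F ι 0
  · rw [Set.indicator_of_mem hx, Set.indicator_of_mem (add_mem_piPrimePowBall hx ht)]
  · have hxt : x + t ∉ piPrimePowBall F ι 0 := fun h => hx (by
      have h' := add_mem_piPrimePowBall h (neg_mem_piPrimePowBall ht)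
      rwa [add_neg_cancel_right] at h')
    rw [Set.indicator_of_notMem hx, Set.indicator_of_notMem hxt]

/-! ## §2 The three kinds of generators fix `1_{𝒪^ι}` -/

include hΦ₀ in
omit [Invertible (2 : F)] [MeasurableSpace F] [BorelSpace F] in
/-- **`r(m(a)) 1_{𝒪^ι} = 1_{𝒪^ι}` for `a` integral with integral inverse**: `|det a|^{-1/2} = 1` and
`a⁻¹ 𝒪^ι = 𝒪^ι`. [cite: MoeglinVignerasWaldspurger1987, Chap. 2 II.6 and II.10; Weil1964, n° 13 and n° 19–20] -/
theorem leviOpPi_integersIndicator (a : (ι → F) ≃ₗ[F] (ι → F))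
    (ha : ∀ i j, LinearMap.toMatrix' (a : (ι → F) →ₗ[F] (ι → F)) i j ∈ primePowBall F 0)
    (ha' : ∀ i j, LinearMap.toMatrix' (a.symm : (ι → F) →ₗ[F] (ι → F)) i j ∈ primePowBall F 0) :
    leviOpPi a Φ₀ = Φ₀ := by
  have hfwd : ∀ u ∈ piPrimePowBall F ι 0, a u ∈ piPrimePowBall F ι 0 := fun u hu => by
    have h := apply_mem_integers_of_integral (a : (ι → F) →ₗ[F] (ι → F)) ha hu
    rwa [LinearEquiv.coe_coe] at h
  have hbwd : ∀ u ∈ piPrimePowBall F ι 0, a.symm u ∈ piPrimePowBall F ι 0 := fun u hu => by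
    have h := apply_mem_integers_of_integral (a.symm : (ι → F) →ₗ[F] (ι → F)) ha' hu
    rwa [LinearEquiv.coe_coe] at h
  refine leviOpPi_eq_self_of_box a Φ₀ (M := 0) (N := 0) (integersIndicator_eq_zero Φ₀ hΦ₀)
    (integersIndicator_add Φ₀ hΦ₀) (modSqrt_eq_one_of_integral a ha ha') (fun u => ⟨fun hu => ?_, hbwd u⟩)
    fun u hu => ?_
  · have h := hfwd _ hu
    rwa [LinearEquiv.apply_symm_apply] at h
  · have h := add_mem_piPrimePowBall (hbwd u hu) (neg_mem_piPrimePowBall hu)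
    rwa [← sub_eq_add_neg] at h

include hΦ₀ in
omit [MeasurableSpace F] [BorelSpace F] in
/-- **`r(n(c)) 1_{𝒪^ι} = 1_{𝒪^ι}` for `c` integral** when `ψ` has conductor `𝒪` and `½ ∈ 𝒪`:
`½⟨u, c u⟩ ∈ 𝒪` on `𝒪^ι`. [cite: MoeglinVignerasWaldspurger1987, Chap. 2 II.6 and II.10; Weil1964, n° 13 and n° 19–20] -/
theorem unipOpPi_integersIndicator (hm0 : ψ.HasConductorExp 0) (h2 : (⅟(2 : F) : F) ∈ primePowBall F 0)
    (c : (ι → F) →ₗ[F] (ι → F)) (hc : ∀ i j, LinearMap.toMatrix' c i j ∈ primePowBall F 0) :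
    unipOpPi hl c Φ₀ = Φ₀ := by
  refine unipOpPi_eq_self_of_box hl hm0 c Φ₀ (M := 0) (integersIndicator_eq_zero Φ₀ hΦ₀) fun u hu => ?_
  rw [halfForm_apply]
  have h := mul_mem_primePowBall h2
    (dotProduct_mem_primePowBall (n := 0) (k := 0) hu (apply_mem_integers_of_integral c hc hu))
  rwa [add_zero, add_zero] at h

omit [DecidableEq ι] [Invertible (2 : F)] in
/-- **`μ^{⊗ι}(𝒪^ι) = 1` for the self-dual measure of a character of conductor `𝒪`** (`μ(𝒪)² = 1`).
[cite: WeilBNT1967, Ch. VII §2, Cor. 3; Weil1964, n° 20] -/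
theorem measureReal_integers_eq_one (hψ : ψ.IsContinuousNontrivial) (hm0 : ψ.HasConductorExp 0)
    (hμ : IsSelfDualMeasure ψ μ) : (Measure.pi fun _ : ι => μ).real (piPrimePowBall F ι 0) = 1 := by
  haveI : SecondCountableTopology F := secondCountableTopology_localField F
  have h := measureReal_mul_measureReal_eq_piSelfDualConst (Measure.pi fun _ : ι => μ) hψ hm0 0
  rw [sub_zero, piSelfDualConst_pi_eq_one μ hψ hm0 hμ, mul_self_eq_one_iff] at h
  rcases h with h | h
  · exact h
  · exact absurd h (ne_of_gt (lt_of_lt_of_le (by norm_num) measureReal_nonneg))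

include hΦ₀ in
omit [DecidableEq ι] [Invertible (2 : F)] in
/-- **`𝓕 1_{𝒪^ι} = 1_{𝒪^ι}`** for `ψ` of conductor `𝒪` and the self-dual measure (`r(w) 1 = 1`).
[cite: WeilBNT1967, Ch. VII §2, Cor. 1; Weil1964, n° 19–20; MoeglinVignerasWaldspurger1987, Chap. 2 II.10] -/
theorem fourierOpPi_integersIndicator_of_isSelfDualMeasure (hψ : ψ.IsContinuousNontrivial)
    (hm0 : ψ.HasConductorExp 0) (hμ : IsSelfDualMeasure ψ μ) : fourierOpPi μ hψ hm0 Φ₀ = Φ₀ := by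
  rw [fourierOpPi_integersIndicator Φ₀ hΦ₀ μ hψ hm0, measureReal_integers_eq_one μ hψ hm0 hμ, Complex.ofReal_one,
    one_smul]

/-! ## §3 The Schrödinger–Leray section on the integral generators -/

include hΦ₀ in
/-- **`r(m(a)) 1_{𝒪^ι} = 1_{𝒪^ι}`** for the Schrödinger–Leray section, `[a], [a⁻¹] ∈ M_ι(𝒪)`.
[cite: MoeglinVignerasWaldspurger1987, Chap. 2 II.10; Rangarao1993, Lemma 3.2 (3.7)] -/
theorem schrodingerLeraySection_leviSp_integersIndicator (hψ : ψ.IsContinuousNontrivial) (hm0 : ψ.HasConductorExp 0)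
    (hμ : IsSelfDualMeasure ψ μ) (a : (ι → F) ≃ₗ[F] (ι → F))
    (ha : ∀ i j, LinearMap.toMatrix' (a : (ι → F) →ₗ[F] (ι → F)) i j ∈ primePowBall F 0)
    (ha' : ∀ i j, LinearMap.toMatrix' (a.symm : (ι → F) →ₗ[F] (ι → F)) i j ∈ primePowBall F 0) :
    schrodingerLeraySection hl μ hψ hm0 hμ
        (leviSp (dotProductBilin F F (m := ι)) a (dualLeviPi a) (dotProductBilin_apply_dualLeviPi a)) Φ₀ = Φ₀ := by
  rw [schrodingerLeraySection_leviSp hl μ hψ hm0 hμ, leviOpPi_integersIndicator Φ₀ hΦ₀ a ha ha']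

include hΦ₀ in
/-- **`r(n(c)) 1_{𝒪^ι} = 1_{𝒪^ι}`** for the Schrödinger–Leray section, `[c] ∈ M_ι(𝒪)` symmetric, `½ ∈ 𝒪`.
[cite: MoeglinVignerasWaldspurger1987, Chap. 2 II.10; Rangarao1993, Lemma 3.2 (3.8)] -/
theorem schrodingerLeraySection_unipotentSp_integersIndicator (hψ : ψ.IsContinuousNontrivial)
    (hm0 : ψ.HasConductorExp 0) (hμ : IsSelfDualMeasure ψ μ) (h2 : (⅟(2 : F) : F) ∈ primePowBall F 0)
    (c : (ι → F) →ₗ[F] (ι → F)) (hcs : ∀ x x' : ι → F, dotProductBilin F F x (c x') = dotProductBilin F F x' (c x))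
    (hc : ∀ i j, LinearMap.toMatrix' c i j ∈ primePowBall F 0) :
    schrodingerLeraySection hl μ hψ hm0 hμ (unipotentSp (dotProductBilin F F (m := ι)) c hcs) Φ₀ = Φ₀ := by
  rw [schrodingerLeraySection_unipotentSp hl μ hψ hm0 hμ, unipOpPi_integersIndicator hl Φ₀ hΦ₀ hm0 h2 c hc]

include hΦ₀ in
/-- **`r(m(a) n(c)) 1_{𝒪^ι} = 1_{𝒪^ι}`** — the section on an integral point of the Siegel parabolic `P_{ℓ_Y}`.
[cite: MoeglinVignerasWaldspurger1987, Chap. 2 II.10; Rangarao1993, Lemma 3.2] -/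
theorem schrodingerLeraySection_leviSp_mul_unipotentSp_integersIndicator (hψ : ψ.IsContinuousNontrivial)
    (hm0 : ψ.HasConductorExp 0) (hμ : IsSelfDualMeasure ψ μ) (h2 : (⅟(2 : F) : F) ∈ primePowBall F 0)
    (a : (ι → F) ≃ₗ[F] (ι → F))
    (ha : ∀ i j, LinearMap.toMatrix' (a : (ι → F) →ₗ[F] (ι → F)) i j ∈ primePowBall F 0)
    (ha' : ∀ i j, LinearMap.toMatrix' (a.symm : (ι → F) →ₗ[F] (ι → F)) i j ∈ primePowBall F 0)
    (c : (ι → F) →ₗ[F] (ι → F)) (hcs : ∀ x x' : ι → F, dotProductBilin F F x (c x') = dotProductBilin F F x' (c x))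
    (hc : ∀ i j, LinearMap.toMatrix' c i j ∈ primePowBall F 0) :
    schrodingerLeraySection hl μ hψ hm0 hμ
        (leviSp (dotProductBilin F F (m := ι)) a (dualLeviPi a) (dotProductBilin_apply_dualLeviPi a) *
          unipotentSp (dotProductBilin F F (m := ι)) c hcs) Φ₀ = Φ₀ := by
  rw [schrodingerLeraySection_leviSp_mul_unipotentSp hl μ hψ hm0 hμ a c hcs, LinearEquiv.mul_apply,
    unipOpPi_integersIndicator hl Φ₀ hΦ₀ hm0 h2 c hc, leviOpPi_integersIndicator Φ₀ hΦ₀ a ha ha']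

include hΦ₀ in
/-- **`r(w) 1_{𝒪^ι} = 𝓕 1_{𝒪^ι} = 1_{𝒪^ι}`** for the Schrödinger–Leray section (conductor `𝒪`, self-dual measure).
[cite: MoeglinVignerasWaldspurger1987, Chap. 2 II.10; Rangarao1993, Lemma 3.2 (3.9); Weil1964, n° 19–20] -/
theorem schrodingerLeraySection_weylSp_integersIndicator (hψ : ψ.IsContinuousNontrivial) (hm0 : ψ.HasConductorExp 0)
    (hμ : IsSelfDualMeasure ψ μ) :
    schrodingerLeraySection hl μ hψ hm0 hμ
        (weylSp (dotProductBilin F F (m := ι)) (LinearEquiv.refl F (ι → F)) (LinearEquiv.neg F)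
          dotProductBilin_refl_neg') Φ₀ = Φ₀ := by
  rw [schrodingerLeraySection_weylSp hl μ hψ hm0 hμ, fourierOpPi_integersIndicator_of_isSelfDualMeasure μ Φ₀ hΦ₀ hψ hm0 hμ]

include hΦ₀ in
/-- **`r(p₁ w p₂) 1_{𝒪^ι} = 1_{𝒪^ι}`** for integral `p₁ = m(a₁) n(c₁)`, `p₂ = m(a₂) n(c₂)` — the section on an
integral point of the big cell `P w P`. [cite: MoeglinVignerasWaldspurger1987, Chap. 2 II.10; Rangarao1993, Thm 3.5 (1)] -/
theorem schrodingerLeraySection_parabolic_weylSp_parabolic_integersIndicator (hψ : ψ.IsContinuousNontrivial)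
    (hm0 : ψ.HasConductorExp 0) (hμ : IsSelfDualMeasure ψ μ) (h2 : (⅟(2 : F) : F) ∈ primePowBall F 0)
    (a₁ a₂ : (ι → F) ≃ₗ[F] (ι → F))
    (ha₁ : ∀ i j, LinearMap.toMatrix' (a₁ : (ι → F) →ₗ[F] (ι → F)) i j ∈ primePowBall F 0)
    (ha₁' : ∀ i j, LinearMap.toMatrix' (a₁.symm : (ι → F) →ₗ[F] (ι → F)) i j ∈ primePowBall F 0)
    (ha₂ : ∀ i j, LinearMap.toMatrix' (a₂ : (ι → F) →ₗ[F] (ι → F)) i j ∈ primePowBall F 0)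
    (ha₂' : ∀ i j, LinearMap.toMatrix' (a₂.symm : (ι → F) →ₗ[F] (ι → F)) i j ∈ primePowBall F 0)
    (c₁ c₂ : (ι → F) →ₗ[F] (ι → F))
    (hc₁s : ∀ x x' : ι → F, dotProductBilin F F x (c₁ x') = dotProductBilin F F x' (c₁ x))
    (hc₂s : ∀ x x' : ι → F, dotProductBilin F F x (c₂ x') = dotProductBilin F F x' (c₂ x))
    (hc₁ : ∀ i j, LinearMap.toMatrix' c₁ i j ∈ primePowBall F 0)
    (hc₂ : ∀ i j, LinearMap.toMatrix' c₂ i j ∈ primePowBall F 0) :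
    schrodingerLeraySection hl μ hψ hm0 hμ
        (leviSp (dotProductBilin F F (m := ι)) a₁ (dualLeviPi a₁) (dotProductBilin_apply_dualLeviPi a₁) *
            unipotentSp (dotProductBilin F F (m := ι)) c₁ hc₁s *
          weylSp (dotProductBilin F F (m := ι)) (LinearEquiv.refl F (ι → F)) (LinearEquiv.neg F)
            dotProductBilin_refl_neg' *
          (leviSp (dotProductBilin F F (m := ι)) a₂ (dualLeviPi a₂) (dotProductBilin_apply_dualLeviPi a₂) *
            unipotentSp (dotProductBilin F F (m := ι)) c₂ hc₂s)) Φ₀ = Φ₀ := by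
  have hp₁ : Submodule.map (((leviSp (dotProductBilin F F (m := ι)) a₁ (dualLeviPi a₁) (dotProductBilin_apply_dualLeviPi a₁) *
      unipotentSp (dotProductBilin F F (m := ι)) c₁ hc₁s : symplecticGroup (polar (dotProductBilin F F (m := ι)))) :
        ((ι → F) × (ι → F)) ≃ₗ[F] ((ι → F) × (ι → F))) : ((ι → F) × (ι → F)) →ₗ[F] ((ι → F) × (ι → F)))
      (Submodule.prod (⊥ : Submodule F (ι → F)) (⊤ : Submodule F (ι → F))) =
        Submodule.prod (⊥ : Submodule F (ι → F)) (⊤ : Submodule F (ι → F)) :=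
    map_prod_bot_top_eq_of _ fun v => by
      rw [Subgroup.coe_mul, LinearEquiv.mul_apply, coe_leviSp_apply, coe_unipotentSp, unipotentσ_apply]
      exact a₁.map_eq_zero_iff
  have hp₂ : Submodule.map (((leviSp (dotProductBilin F F (m := ι)) a₂ (dualLeviPi a₂) (dotProductBilin_apply_dualLeviPi a₂) *
      unipotentSp (dotProductBilin F F (m := ι)) c₂ hc₂s : symplecticGroup (polar (dotProductBilin F F (m := ι)))) :
        ((ι → F) × (ι → F)) ≃ₗ[F] ((ι → F) × (ι → F))) : ((ι → F) × (ι → F)) →ₗ[F] ((ι → F) × (ι → F)))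
      (Submodule.prod (⊥ : Submodule F (ι → F)) (⊤ : Submodule F (ι → F))) =
        Submodule.prod (⊥ : Submodule F (ι → F)) (⊤ : Submodule F (ι → F)) :=
    map_prod_bot_top_eq_of _ fun v => by
      rw [Subgroup.coe_mul, LinearEquiv.mul_apply, coe_leviSp_apply, coe_unipotentSp, unipotentσ_apply]
      exact a₂.map_eq_zero_iff
  rw [schrodingerLeraySection_parabolic_weylSp_parabolic hl μ hψ hm0 hμ hp₁ hp₂, LinearEquiv.mul_apply,
    LinearEquiv.mul_apply, schrodingerLeraySection_leviSp_mul_unipotentSp hl μ hψ hm0 hμ a₂ c₂ hc₂s,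
    LinearEquiv.mul_apply, unipOpPi_integersIndicator hl Φ₀ hΦ₀ hm0 h2 c₂ hc₂, leviOpPi_integersIndicator Φ₀ hΦ₀ a₂ ha₂ ha₂',
    fourierOpPi_integersIndicator_of_isSelfDualMeasure μ Φ₀ hΦ₀ hψ hm0 hμ,
    schrodingerLeraySection_leviSp_mul_unipotentSp hl μ hψ hm0 hμ a₁ c₁ hc₁s, LinearEquiv.mul_apply,
    unipOpPi_integersIndicator hl Φ₀ hΦ₀ hm0 h2 c₁ hc₁, leviOpPi_integersIndicator Φ₀ hΦ₀ a₁ ha₁ ha₁']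

end Pi

end Literature.RepresentationTheory.HeisenbergGroup

end
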